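import Summits.BirchSwinnertonDyer.Rank1Residual.JET.CarrierReadingRecordsKit
import HarnessLib

/-!
# BSD rank-≤1 residual cell, lane class X11b (`3 ∥ N`: MULTIPLICATIVE at `3`, `ρ̄_{E,3}` onto), rank ONE, Tamagawa-OBSTRUCTED with ONE carrier
# prime: `BSD(E,3)` PER CELL through the JET lane's R-IDX kit doors `JET.bsdp_of_jetRowA3_tam_min` / `_tamX_min` (carrier `q ≠ 3`, READING
# binder K1) and `JET.bsdp_of_jetRowB3_tam_min` (carrier `3`, READING binder K3) on a two-engine HEEGNER-INDEX line in a DEEP field — records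
# 07 (x11c GEN 36 «J1-REMAINDER / KOLY-R»)

HONEST FRAMING (cell `b2b-bsdres-*`, verbatim): prove what is provable now; shrink each hard class to its core with data; no claim beyond
stated classes; COMBINATION classes deleted from PUBLISHED theorems only, CONSTRUCTION-shaped remainder typed; this is not "finishing BSD".
X4 / X11b (and X11 ∧ r = 1 ∧ p = 3) stay CONSTRUCTION-SHAPED; everything here is PER CELL; no lane verdict is changed; NO named fact is
introduced (debt 0) and NO definition; nothing is booked by this file (bookings are referee A's, pub-bsdpct); Cremona's numbers (`r_an`,
`#Ш_an`, models, generators, `∏ c_ℓ`, torsion, optimality / Manin codes, the galrep datum) and the Kurihara lane's per-prime tables are INPUTS.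

Unit `b2b-bsdres-x11c`, GEN 36 (prover-b2b-bsdres-x11c-g36-0), move «J1-REMAINDER / KOLY-R». POPULATION (`HOME/b2b-bsdres-x11c/gen36/pop/`:
`census36.py` over referee A's ROUND 983 state of record × the Kurihara lane's sweep records × Cremona, then `build_pop36.py`): EVERY live
residue cell on the Kolyvagin / Jetchev road classes (X4, X7, X8, X11a, X11b), BOTH ranks, odd `p`, whose shape is KOLY (`ρ̄_{E,p}` onto,
`p ∤ #E(ℚ)_tors·∏c·#Ш_an`: 30 cells) or J1 (onto, `p ∤ #E(ℚ)_tors·#Ш_an`, exactly ONE prime `q ∣ N` with `p ∣ c_q`: 171 cells; the two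
J1 cells whose carrier is an ADDITIVE `p` have no door and are excluded) — 199 cells on 191 classes (188 of them with this cell as their ONLY
open cell): 82 rank-one `(3, X11b)`, 59 `(5, X4)` + 2 `(7, X4)` (rank one 19 / rank zero 42), 26 `(3, X4)` J1 (1 / 25), 20 `(3, X4)` KOLY
(6 / 14), 10 KOLY at `p ≥ 5`. The lane never certified them: at rank one its Heegner fields (`|D| ≤ 1511`) read `ord_p [E(K):ℤy_K] = w + 1`
or found no admissible field; at rank zero (additive `p`) no Heegner-index line was ever run. THIS UNIT ran the cell's engines VERBATIM in
DEEPER fields: engine 1 = gen 3 `engine1_cha1b/main.py` = x9-g7 `jobD1b.py` (cypari2, sha256 `69e29ec7…`; rank-one mode: Cremona's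
generator, `hy = L'(E,1)·L(E^D,1)·√|D|/(4·Area)`, `m = √(4·hy/ĥ(P))`; rank-zero mode: the rank-one twist `F = E^D`, a point `x ∈ F(ℚ)` by
`ellrank`, saturated, `hy = L(E,1)·L'(F,1)·√|D|/(4·Area)`, `m = √(4·hy/ĥ(x))` — Miller 2011 Thm. 4.1 / Cor. 4.8; `NDISC 16`, `DBOUND 6000`);
engine 2 = gen 3 `run_cert.py` (`1b54bb20…`) + `e2lib.py` + `tate_stdlib.py` (stdlib re-implementation: `m`, `ord_p m` must be EQUAL,
discrete checks); twist values = additive-p1 `twistvals/main.py` (`e501b988…`). Kit jobs: see HOME/b2b-bsdres-x11c/gen36/harvest/JOBS-gen36.txt. Evidence `HOME/b2b-bsdres-x11c/gen36/`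
(POP36.md, ROWS36-TABLE.md, harvest outputs with inputs.sha256, SHA256SUMS); REPORT.md §45.

THE ROAD (cell `bsd-jet`'s R-IDX grammar, the doors referee A priced at pub-bsdpct ROUNDS 409 / 516 / 600 and booked this unit's
JDEEP rows on at ROUND 890): Jetchev 2008 Thm. 1.4 / Cor. 1.5 READ at the ONE Tamagawa carrier — READING binder K1
`JET.JetchevDivisibilityCarrierNe` (p459625; carrier `q ≠ p`) or K3 `JET.JetchevDivisibilityCarrierMult` (p463660; carrier `q = p` split
multiplicative), both `@[conjecture]` typed readings CONSUMED AS HYPOTHESES (nothing about K1 / K3 is asserted here) — + McCallum 1991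
Cor. 5.6 (`hMcU`), GZK (`hGZK`), Kolyvagin / Gross–Zagier bookkeeping (`hKo`, `hrec`, `hD36`, `hlev`): with `w = ord_p c_q` at the carrier
and a Heegner field `K` in which `ord_p [E(K):ℤy_K] ≤ w`, `Ш(E/ℚ)[p] = 0`, and with `ord_p #Ш_an = 0`, Miller's `BSD(E,p)`.
IN THE KERNEL per cell (`decide` / `norm_num` goals of ONE kit application): the literal Cremona model (`Δ ≠ 0`; global minimality by the
factored Kraus criterion `Supersingular.isGloballyMinimal_of_krausCriterion₃_factored` on the COMPLETE factorisation of `|Δ|`); `ρ̄_{E,p}`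
ONTO (Serre 1972: three Prop-19 witnesses at `p ≥ 5` / an irreducible Frobenius + a Frobenius of order `3` at `p = 3`; the `p`-adic tower
inside the door: Serre IV-23 at `p ≥ 5`, the Tate line at a multiplicative `3`, ONE Frobenius witness mod `9` otherwise); at a
multiplicative `3`: `3 ∣ Δ`, `3 ∤ c₄`; the carrier's Tamagawa number from ONE `TamLocal` (split `I_n`) or exact `TamX` (`IV` / `IV*`)
certificate (n1011-p03's bridges `Additive.IntModelTam.localTamagawaNumber_padic_eq_of_intModel_of_tamLocal` / `_of_tamX`) and
`w ≤ ord_p c_q`. DISPLAYED (hypotheses of every record): `hJ` (READING), `hMcU`, `hGZK`, `hKo`, `hrec`, `hD36`, `hlev`; the Heegner datum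
(`K` imaginary quadratic, `d_K ∉ {−3, −4}`, Heegner hypothesis for the level `N`, `P` a Heegner point of infinite order), bucket A: `q ∣ N`;
the INDEX LINE `hv : ord_p [E(K):ℤP] ≤ w` — THIS UNIT's two-engine deep-field datum, quoted per docstring, NOT re-computed here —;
`hr : r_an ≤ 1`; `hs` / `hvs` : `#Ш_an` a `p`-adic unit (Cremona; exact at rank 0).
What a record is worth is the referee's call (EVIDENCE-grade certificate under displayed binders, as every Heegner-index record of the
cell). Cells in this file: `393420c1`@3, `397110bd1`@3, `398046d1`@3, `406770bl1`@3, `408090j1`@3, `409146e1`@3, `412230cm1`@3.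

References: D. Jetchev, Compos. Math. 144 (2008) Thm. 1.4, Cor. 1.5 [Jetchev2008]; W. McCallum, LMS LN 153 (1991) §1, Cor. 5.6
[McCallumLMS1991]; B. H. Gross, LMS LN 153 (1991) Prop. 2.1 [GrossLMS1991]; V. A. Kolyvagin (1990) [KolyvaginEulerSystems1990];
J.-P. Serre, Invent. Math. 15 (1972) §2.4 Prop. 15, §2.8 Prop. 19 [Serre1972]; J.-P. Serre, *Abelian ℓ-adic representations* IV-23
[SerreAbelianLadic1968]; B. H. Gross, D. Zagier, Invent. Math. 84 (1986) [GrossZagier1986]; R. L. Miller, LMS J. Comput. Math. 14 (2011)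
Thm. 4.1, Cor. 4.8, Def. 1.1 [Miller2011LMS]; C. Wuthrich, Doc. Math. 19 (2014) Lemma 20 [Wuthrich2014]; J. H. Silverman, *AEC* (2009)
VII.1, VII.5 [SilvermanAEC2009], *ATAEC* (1994) IV.9.4 [SilvermanATAEC1994]; A. Kraus, Acta Arith. 54 (1989) [Kraus1989]; Cremona's
tables [Cremona2006].
-/

set_option autoImplicit false

noncomputable section

open scoped Classical

open WeierstrassCurve Literature.NumberTheory.EllipticCurves
  Literature.NumberTheory.EllipticCurves.ModularForms
  Literature.NumberTheory.EllipticCurves.Rank1Residual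
  Literature.NumberTheory.EllipticCurves.Rank1Residual.Typed
  Literature.NumberTheory.EllipticCurves.Rank1Residual.X11RankOneCertificates
  Summit.BirchSwinnertonDyer.BirchSwinnertonDyer.Rank1Residual
  Summit.BirchSwinnertonDyer.BirchSwinnertonDyer.Rank1Residual.IntModel
  Summit.BirchSwinnertonDyer.BirchSwinnertonDyer.Rank1Residual.X11RankOne
  Summit.BirchSwinnertonDyer.BirchSwinnertonDyer.Rank2Observatory.Tam
  Summit.BirchSwinnertonDyer.Rank1Residual.JET

namespace Summit.BirchSwinnertonDyer.Rank1Residual.X11b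

/-- **`BSD(E,3)` for `393420c1`** (cell `(393420c1, 3)`, class X11b, rank 1; JET grammar key `JETA:393420c1@3`, bucket A at `p = 3 ∥ N` (door
`JET.bsdp_of_jetRowA3_tamX_min`)); `N = 393420 = 2^2·3·5·79·83`, nonsplit `I8` at `3`, `r_an = 1`, `#E(ℚ)_tors = 1`, `∏c = 12`, `#Ш_an = 1`, Cremona
galrep: no code at this prime (`ρ̄_{E,3}` onto); `|Δ| = ∏` over `[(2, 8), (3, 8), (5, 2), (79, 1), (83, 1)]` (factored Kraus criterion, every
disjunct decided). The ONE carrier: carrier `q = 2` ADDITIVE of type `IV*` (`c_q = 3`, `w = ord_3 c_q = 1`; IN THE KERNEL by the exact `TamX`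
certificate `⟨2, 1, 3, 2, 1, 2, 8, 0⟩`); READING binder `hJ` = K1 `JetchevDivisibilityCarrierNe`; displayed index line `hv : ord_3 [E(K):ℤP] ≤ 1`.
Serre Prop-15 witnesses mod `3`: `(ℓ, #Ẽ(𝔽_ℓ))` = `(7, 11)` (`X² − aX + ℓ` root-free over `𝔽₃`), `(19, 15)` (`ℓ ≡ 1`, `a ≡ 2 (mod 3)`, `9 ∤ #Ẽ`).
Kurihara lane note of record: «multiplicative p, r=1, irr (Castella 2018 Thm A withdrawn for p||N)». State of record (referee A ROUND 983,
`scratchA_A_state_after_x4gh_add3_onA2R977_fold.pkl`): class `residue`, 1 open cell(s), register empty. Other engine-1 fields tried (`D`: `m`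
(`ord_3 m`)): `-71`: `m = 72` (`ord = 2`); `-1799`: `m = 72` (`ord = 2`); `-2591`: `m = 72` (`ord = 2`); `-2879`: `m = 24` (`ord = 1`); `-3359`: `m
= 24` (`ord = 1`); `-3671`: `m = 24` (`ord = 1`); `-3719`: `m = 24` (`ord = 1`); `-3791`: `m = 72` (`ord = 2`); `-5159`: `m = 72` (`ord = 2`);
`-5231`: `m = 72` (`ord = 2`); `-5351`: `m = 48` (`ord = 1`); `-5759`: `m = 96` (`ord = 1`). THIS UNIT'S DATUM (displayed, NOT re-computed here):
DEEP FIELD `K = ℚ(√-1871)` (`1871` = prime): **`m = [E(K):ℤy_K] = 48`, `ord_3 m = 1`** (`ρ = m²/4`, `L'(E,1) = 7.5022735999`, `L(E^D,1) =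
0.8798987386`, `ĥ(P) = 0.7241657763`; Cremona's generator) — engine 1 j293228 = engine 2 j293889: `m = 48` EQUAL (AGREE v_p(m)=1, dev ≤ 4.4e-14);
twist `E^D` (j293892): `N = 1377222182220`, `#tors·∏c·#Ш_an = 1·24·4`, `ord_3 #Ш_an(E^D) = 0`, `ord_3 ∏c(E^D) = 1` (BSD-consistent). CONDITIONAL on
every binder; per cell; nothing booked by this file.
[cite: Jetchev2008, Thm. 1.4 and Cor. 1.5 (p. 812)] [cite: McCallumLMS1991, Cor. 5.6] [cite: Serre1972, §2.4 Prop. 15, §2.8 Prop. 19] [cite: Cremona2006, Table 1 (label 393420c1)] -/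
theorem bsdpJD_393420c1_3
    (hJ : JetchevDivisibilityCarrierNe)
    (hMcU : McCallum1991_padicValNat_card_sha_primary_add_le_of_globalDivisibility)
    (hGZK : rank_eq_analyticRank_of_analyticRank_le_one)
    (hKo : ∀ (N : ℕ) [NeZero N] (W : WeierstrassCurve ℚ) (K : Type) [Field K] [NumberField K], kolyvagin N W K)
    (hrec : ∀ (N : ℕ) [NeZero N] (W : WeierstrassCurve ℚ) (K : Type) [Field K] [NumberField K],
      heegnerPointOfConductor_one_galoisConj N W K)
    (hD36 : ∀ (N : ℕ) [NeZero N] (W : WeierstrassCurve ℚ) (K : Type) [Field K] [NumberField K],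
      phi_heegnerTau_mem_singularModuliField N W K)
    (hlev : ∀ {N : ℕ} [NeZero N], IsNewformOf.level_eq_conductorNorm (N := N))
    (W : WeierstrassCurve ℚ) (hW : W = ⟨0, -1, 0, -980, 28200⟩)
    {N : ℕ} [NeZero N] {K : Type} [Field K] [NumberField K] (hK : IsImaginaryQuadratic K)
    (hD3 : NumberField.discr K ≠ -3) (hD4 : NumberField.discr K ≠ -4)
    (hH : SatisfiesHeegnerHypothesis N K) {P : (W.baseChange K).toAffine.Point}
    (hP : IsHeegnerPoint N W K P) (hnt : ¬ IsOfFinAddOrder P) (hqN : 2 ∣ N)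
    (hv : padicValNat 3 (AddSubgroup.zmultiples P).index ≤ 1)
    (hr : W.analyticRank ≤ 1) {s : ℚ} (hs : shaAn W = (s : ℂ)) (hvs : padicValRat 3 s = 0) : BSDp W 3 :=
  bsdp_of_jetRowA3_tamX_min 0 (-1) 0 (-980) 28200
    (Supersingular.isGloballyMinimal_of_krausCriterion₃_factored 0 (-1) 0 (-980) 28200 [(2, 8), (3, 8), (5, 2), (79, 1), (83, 1)] (by decide +kernel)
      (by intro t ht; fin_cases ht <;> norm_num) (by decide +kernel))
    (by decide +kernel) (by decide +kernel)
    7 19 (by norm_num) (by norm_num) (by decide) (by decide) (by decide) (by decide) (by decide +kernel) (by decide +kernel)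
    (n₁ := 11) (n₂ := 15) (by decide +kernel) (by decide +kernel) (by decide) (by decide) (by decide) (by decide)
    2 (by norm_num) ⟨2, 1, 3, 2, 1, 2, 8, 0⟩ rfl (by decide +kernel) (w := 1) (by decide +kernel) (by decide)
    hJ hMcU hGZK hKo hrec hD36 hlev W hW hK hD3 hD4 hH hP hnt hqN hv hr hs hvs

/-- **`BSD(E,3)` for `397110bd1`** (cell `(397110bd1, 3)`, class X11b, rank 1; JET grammar key `JETA:397110bd1@3`, bucket A at `p = 3 ∥ N` (door
`JET.bsdp_of_jetRowA3_tam_min`)); `N = 397110 = 2·3·5·7·31·61`, nonsplit `I4` at `3`, `r_an = 1`, `#E(ℚ)_tors = 2`, `∏c = 72`, `#Ш_an = 1`, Cremona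
galrep: no code at this prime (`ρ̄_{E,3}` onto); `|Δ| = ∏` over `[(2, 18), (3, 4), (5, 1), (7, 14), (31, 5), (61, 1)]` (factored Kraus criterion,
every disjunct decided). The ONE carrier: carrier `q = 2` (split `I18`, `c_q = 18`, `w = ord_3 c_q = 2`; IN THE KERNEL by the `TamLocal` certificate
`⟨2, 1, 1, 0, 0, 0, 0, 18, 0, 0, 18⟩`); READING binder `hJ` = K1 `JetchevDivisibilityCarrierNe`; displayed index line `hv : ord_3 [E(K):ℤP] ≤ 2`.
Serre Prop-15 witnesses mod `3`: `(ℓ, #Ẽ(𝔽_ℓ))` = `(11, 16)` (`X² − aX + ℓ` root-free over `𝔽₃`), `(19, 24)` (`ℓ ≡ 1`, `a ≡ 2 (mod 3)`, `9 ∤ #Ẽ`).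
Kurihara lane note of record: «multiplicative p, r=1, irr (Castella 2018 Thm A withdrawn for p||N)». State of record (referee A ROUND 983,
`scratchA_A_state_after_x4gh_add3_onA2R977_fold.pkl`): class `residue`, 1 open cell(s), register empty. Other engine-1 fields tried (`D`: `m`
(`ord_3 m`)): `-719`: `m = 216` (`ord = 3`); `-1391`: `m = 432` (`ord = 3`); `-1511`: `m = 648` (`ord = 4`); `-2399`: `m = 432` (`ord = 3`);
`-3359`: `m = 504` (`ord = 2`); `-3839`: `m = 144` (`ord = 2`); `-5759`: `m = 144` (`ord = 2`). THIS UNIT'S DATUM (displayed, NOT re-computed here):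
DEEP FIELD `K = ℚ(√-3191)` (`3191` = prime): **`m = [E(K):ℤy_K] = 360`, `ord_3 m = 2`** (`ρ = m²/4`, `L'(E,1) = 5.4939102498`, `L(E^D,1) =
1.9226214980`, `ĥ(P) = 24.058587897`; Cremona's generator) — engine 1 j293234 = engine 2 j294330: `m = 360` EQUAL (AGREE v_p(m)=2, dev ≤ 1.4e-13);
twist `E^D` (j294332): `N = 4043565029910`, `#tors·∏c·#Ш_an = 2·144·100`, `ord_3 #Ш_an(E^D) = 0`, `ord_3 ∏c(E^D) = 2` (BSD-consistent). CONDITIONAL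
on every binder; per cell; nothing booked by this file.
[cite: Jetchev2008, Thm. 1.4 and Cor. 1.5 (p. 812)] [cite: McCallumLMS1991, Cor. 5.6] [cite: Serre1972, §2.4 Prop. 15, §2.8 Prop. 19] [cite: Cremona2006, Table 1 (label 397110bd1)] -/
theorem bsdpJD_397110bd1_3
    (hJ : JetchevDivisibilityCarrierNe)
    (hMcU : McCallum1991_padicValNat_card_sha_primary_add_le_of_globalDivisibility)
    (hGZK : rank_eq_analyticRank_of_analyticRank_le_one)
    (hKo : ∀ (N : ℕ) [NeZero N] (W : WeierstrassCurve ℚ) (K : Type) [Field K] [NumberField K], kolyvagin N W K)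
    (hrec : ∀ (N : ℕ) [NeZero N] (W : WeierstrassCurve ℚ) (K : Type) [Field K] [NumberField K],
      heegnerPointOfConductor_one_galoisConj N W K)
    (hD36 : ∀ (N : ℕ) [NeZero N] (W : WeierstrassCurve ℚ) (K : Type) [Field K] [NumberField K],
      phi_heegnerTau_mem_singularModuliField N W K)
    (hlev : ∀ {N : ℕ} [NeZero N], IsNewformOf.level_eq_conductorNorm (N := N))
    (W : WeierstrassCurve ℚ) (hW : W = ⟨1, 1, 1, -1083047651, -21893255197567⟩)
    {N : ℕ} [NeZero N] {K : Type} [Field K] [NumberField K] (hK : IsImaginaryQuadratic K)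
    (hD3 : NumberField.discr K ≠ -3) (hD4 : NumberField.discr K ≠ -4)
    (hH : SatisfiesHeegnerHypothesis N K) {P : (W.baseChange K).toAffine.Point}
    (hP : IsHeegnerPoint N W K P) (hnt : ¬ IsOfFinAddOrder P) (hqN : 2 ∣ N)
    (hv : padicValNat 3 (AddSubgroup.zmultiples P).index ≤ 2)
    (hr : W.analyticRank ≤ 1) {s : ℚ} (hs : shaAn W = (s : ℂ)) (hvs : padicValRat 3 s = 0) : BSDp W 3 :=
  bsdp_of_jetRowA3_tam_min 1 1 1 (-1083047651) (-21893255197567)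
    (Supersingular.isGloballyMinimal_of_krausCriterion₃_factored 1 1 1 (-1083047651) (-21893255197567) [(2, 18), (3, 4), (5, 1), (7, 14), (31, 5), (61, 1)] (by decide +kernel)
      (by intro t ht; fin_cases ht <;> norm_num) (by decide +kernel))
    (by decide +kernel) (by decide +kernel)
    11 19 (by norm_num) (by norm_num) (by decide) (by decide) (by decide) (by decide) (by decide +kernel) (by decide +kernel)
    (n₁ := 16) (n₂ := 24) (by decide +kernel) (by decide +kernel) (by decide) (by decide) (by decide) (by decide)
    2 ⟨2, 1, 1, 0, 0, 0, 0, 18, 0, 0, 18⟩ rfl (by decide +kernel) (c := 18) (by decide +kernel) (w := 2) (by decide +kernel) (by decide)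
    hJ hMcU hGZK hKo hrec hD36 hlev W hW hK hD3 hD4 hH hP hnt hqN hv hr hs hvs

/-- **`BSD(E,3)` for `398046d1`** (cell `(398046d1, 3)`, class X11b, rank 1; JET grammar key `JETB:398046d1@3`, bucket B at `p = 3 ∥ N`, carrier `3`
(door `JET.bsdp_of_jetRowB3_tam_min`)); `N = 398046 = 2·3·11·37·163`, split `I24` at `3`, `r_an = 1`, `#E(ℚ)_tors = 1`, `∏c = 24`, `#Ш_an = 1`,
Cremona galrep: no code at this prime (`ρ̄_{E,3}` onto); `|Δ| = ∏` over `[(2, 7), (3, 24), (11, 1), (37, 1), (163, 1)]` (factored Kraus criterion,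
every disjunct decided). The ONE carrier: carrier `q = 3` (split `I24`, `c_q = 24`, `w = ord_3 c_q = 1`; IN THE KERNEL by the `TamLocal` certificate
`⟨3, 1, 1, 0, 0, 0, 0, 24, 0, 0, 24⟩`); READING binder `hJ` = K3 `JetchevDivisibilityCarrierMult`; displayed index line `hv : ord_3 [E(K):ℤP] ≤ 1`.
Serre Prop-15 witnesses mod `3`: `(ℓ, #Ẽ(𝔽_ℓ))` = `(31, 32)` (`X² − aX + ℓ` root-free over `𝔽₃`), `(13, 21)` (`ℓ ≡ 1`, `a ≡ 2 (mod 3)`, `9 ∤ #Ẽ`).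
Kurihara lane note of record: «multiplicative p, r=1, irr (Castella 2018 Thm A withdrawn for p||N)». State of record (referee A ROUND 983,
`scratchA_A_state_after_x4gh_add3_onA2R977_fold.pkl`): class `residue`, 1 open cell(s), register empty. Other engine-1 fields tried (`D`: `m`
(`ord_3 m`)): `-887`: `m = 144` (`ord = 2`); `-1823`: `m = 48` (`ord = 1`); `-2327`: `m = 48` (`ord = 1`); `-2615`: `m = 384` (`ord = 1`); `-2639`:
`m = 336` (`ord = 1`); `-2735`: `m = 192` (`ord = 1`); `-2879`: `m = 192` (`ord = 1`); `-3263`: `m = 240` (`ord = 1`); `-3383`: `m = 192` (`ord =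
1`); `-3407`: `m = 96` (`ord = 1`); `-3599`: `m = 288` (`ord = 2`). THIS UNIT'S DATUM (displayed, NOT re-computed here): DEEP FIELD `K = ℚ(√-1487)`
(`1487` = prime): **`m = [E(K):ℤy_K] = 96`, `ord_3 m = 1`** (`ρ = m²/4`, `L'(E,1) = 6.7131212702`, `L(E^D,1) = 0.4645804757`, `ĥ(P) = 1.1482132134`;
Cremona's generator) — engine 1 j293239 = engine 2 j294065: `m = 96` EQUAL (AGREE v_p(m)=1, dev ≤ 1.1e-13); twist `E^D` (j294066): `N =
880146975774`, `#tors·∏c·#Ш_an = 1·48·4`, `ord_3 #Ш_an(E^D) = 0`, `ord_3 ∏c(E^D) = 1` (BSD-consistent). CONDITIONAL on every binder; per cell;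
nothing booked by this file.
[cite: Jetchev2008, Thm. 1.4 and Cor. 1.5 (p. 812)] [cite: McCallumLMS1991, Cor. 5.6] [cite: Serre1972, §2.4 Prop. 15, §2.8 Prop. 19] [cite: Cremona2006, Table 1 (label 398046d1)] -/
theorem bsdpJD_398046d1_3
    (hJ : JetchevDivisibilityCarrierMult)
    (hMcU : McCallum1991_padicValNat_card_sha_primary_add_le_of_globalDivisibility)
    (hGZK : rank_eq_analyticRank_of_analyticRank_le_one)
    (hKo : ∀ (N : ℕ) [NeZero N] (W : WeierstrassCurve ℚ) (K : Type) [Field K] [NumberField K], kolyvagin N W K)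
    (hrec : ∀ (N : ℕ) [NeZero N] (W : WeierstrassCurve ℚ) (K : Type) [Field K] [NumberField K],
      heegnerPointOfConductor_one_galoisConj N W K)
    (hD36 : ∀ (N : ℕ) [NeZero N] (W : WeierstrassCurve ℚ) (K : Type) [Field K] [NumberField K],
      phi_heegnerTau_mem_singularModuliField N W K)
    (hlev : ∀ {N : ℕ} [NeZero N], IsNewformOf.level_eq_conductorNorm (N := N))
    (W : WeierstrassCurve ℚ) (hW : W = ⟨1, 0, 1, -400261, 122651696⟩)
    {N : ℕ} [NeZero N] {K : Type} [Field K] [NumberField K] (hK : IsImaginaryQuadratic K)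
    (hD3 : NumberField.discr K ≠ -3) (hD4 : NumberField.discr K ≠ -4)
    (hH : SatisfiesHeegnerHypothesis N K) {P : (W.baseChange K).toAffine.Point}
    (hP : IsHeegnerPoint N W K P) (hnt : ¬ IsOfFinAddOrder P)
    (hv : padicValNat 3 (AddSubgroup.zmultiples P).index ≤ 1)
    (hr : W.analyticRank ≤ 1) {s : ℚ} (hs : shaAn W = (s : ℂ)) (hvs : padicValRat 3 s = 0) : BSDp W 3 :=
  bsdp_of_jetRowB3_tam_min 1 0 1 (-400261) 122651696
    (Supersingular.isGloballyMinimal_of_krausCriterion₃_factored 1 0 1 (-400261) 122651696 [(2, 7), (3, 24), (11, 1), (37, 1), (163, 1)] (by decide +kernel)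
      (by intro t ht; fin_cases ht <;> norm_num) (by decide +kernel))
    (by decide +kernel) (by decide +kernel)
    31 13 (by norm_num) (by norm_num) (by decide) (by decide) (by decide) (by decide) (by decide +kernel) (by decide +kernel)
    (n₁ := 32) (n₂ := 21) (by decide +kernel) (by decide +kernel) (by decide) (by decide) (by decide) (by decide)
    ⟨3, 1, 1, 0, 0, 0, 0, 24, 0, 0, 24⟩ rfl (by decide +kernel) (c := 24) (by decide +kernel) (w := 1) (by decide +kernel)
    hJ hMcU hGZK hKo hrec hD36 hlev W hW hK hD3 hD4 hH hP hnt hv hr hs hvs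

/-- **`BSD(E,3)` for `406770bl1`** (cell `(406770bl1, 3)`, class X11b, rank 1; JET grammar key `JETA:406770bl1@3`, bucket A at `p = 3 ∥ N` (door
`JET.bsdp_of_jetRowA3_tam_min`)); `N = 406770 = 2·3·5·7·13·149`, nonsplit `I1` at `3`, `r_an = 1`, `#E(ℚ)_tors = 1`, `∏c = 15`, `#Ш_an = 1`, Cremona
galrep: no code at this prime (`ρ̄_{E,3}` onto); `|Δ| = ∏` over `[(2, 15), (3, 1), (5, 1), (7, 1), (13, 1), (149, 1)]` (factored Kraus criterion,
every disjunct decided). The ONE carrier: carrier `q = 2` (split `I15`, `c_q = 15`, `w = ord_3 c_q = 1`; IN THE KERNEL by the `TamLocal` certificate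
`⟨2, 1, 1, 0, 0, 0, 0, 15, 0, 0, 15⟩`); READING binder `hJ` = K1 `JetchevDivisibilityCarrierNe`; displayed index line `hv : ord_3 [E(K):ℤP] ≤ 1`.
Serre Prop-15 witnesses mod `3`: `(ℓ, #Ẽ(𝔽_ℓ))` = `(17, 14)` (`X² − aX + ℓ` root-free over `𝔽₃`), `(43, 51)` (`ℓ ≡ 1`, `a ≡ 2 (mod 3)`, `9 ∤ #Ẽ`).
Kurihara lane note of record: «multiplicative p, r=1, irr (Castella 2018 Thm A withdrawn for p||N)». State of record (referee A ROUND 983,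
`scratchA_A_state_after_x4gh_add3_onA2R977_fold.pkl`): class `residue`, 1 open cell(s), register empty. Other engine-1 fields tried (`D`: `m`
(`ord_3 m`)): `-719`: `m = 90` (`ord = 2`); `-1559`: `m = 90` (`ord = 2`); `-4871`: `m = 180` (`ord = 2`); `-5711`: `m = 210` (`ord = 1`); `-5879`:
`m = 180` (`ord = 2`). THIS UNIT'S DATUM (displayed, NOT re-computed here): DEEP FIELD `K = ℚ(√-2159)` (`2159` = 17·127): **`m = [E(K):ℤy_K] = 60`,
`ord_3 m = 1`** (`ρ = m²/4`, `L'(E,1) = 9.6869042852`, `L(E^D,1) = 0.9158059289`, `ĥ(P) = 0.4817723522`; Cremona's generator) — engine 1 j293228 =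
engine 2 j293889: `m = 60` EQUAL (AGREE v_p(m)=1, dev ≤ 9.9e-14); twist `E^D` (j293892): `N = 1896069272370`, `#tors·∏c·#Ш_an = 1·120·1`, `ord_3
#Ш_an(E^D) = 0`, `ord_3 ∏c(E^D) = 1` (BSD-consistent). CONDITIONAL on every binder; per cell; nothing booked by this file.
[cite: Jetchev2008, Thm. 1.4 and Cor. 1.5 (p. 812)] [cite: McCallumLMS1991, Cor. 5.6] [cite: Serre1972, §2.4 Prop. 15, §2.8 Prop. 19] [cite: Cremona2006, Table 1 (label 406770bl1)] -/
theorem bsdpJD_406770bl1_3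
    (hJ : JetchevDivisibilityCarrierNe)
    (hMcU : McCallum1991_padicValNat_card_sha_primary_add_le_of_globalDivisibility)
    (hGZK : rank_eq_analyticRank_of_analyticRank_le_one)
    (hKo : ∀ (N : ℕ) [NeZero N] (W : WeierstrassCurve ℚ) (K : Type) [Field K] [NumberField K], kolyvagin N W K)
    (hrec : ∀ (N : ℕ) [NeZero N] (W : WeierstrassCurve ℚ) (K : Type) [Field K] [NumberField K],
      heegnerPointOfConductor_one_galoisConj N W K)
    (hD36 : ∀ (N : ℕ) [NeZero N] (W : WeierstrassCurve ℚ) (K : Type) [Field K] [NumberField K],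
      phi_heegnerTau_mem_singularModuliField N W K)
    (hlev : ∀ {N : ℕ} [NeZero N], IsNewformOf.level_eq_conductorNorm (N := N))
    (W : WeierstrassCurve ℚ) (hW : W = ⟨1, 1, 1, -2050, 35087⟩)
    {N : ℕ} [NeZero N] {K : Type} [Field K] [NumberField K] (hK : IsImaginaryQuadratic K)
    (hD3 : NumberField.discr K ≠ -3) (hD4 : NumberField.discr K ≠ -4)
    (hH : SatisfiesHeegnerHypothesis N K) {P : (W.baseChange K).toAffine.Point}
    (hP : IsHeegnerPoint N W K P) (hnt : ¬ IsOfFinAddOrder P) (hqN : 2 ∣ N)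
    (hv : padicValNat 3 (AddSubgroup.zmultiples P).index ≤ 1)
    (hr : W.analyticRank ≤ 1) {s : ℚ} (hs : shaAn W = (s : ℂ)) (hvs : padicValRat 3 s = 0) : BSDp W 3 :=
  bsdp_of_jetRowA3_tam_min 1 1 1 (-2050) 35087
    (Supersingular.isGloballyMinimal_of_krausCriterion₃_factored 1 1 1 (-2050) 35087 [(2, 15), (3, 1), (5, 1), (7, 1), (13, 1), (149, 1)] (by decide +kernel)
      (by intro t ht; fin_cases ht <;> norm_num) (by decide +kernel))
    (by decide +kernel) (by decide +kernel)
    17 43 (by norm_num) (by norm_num) (by decide) (by decide) (by decide) (by decide) (by decide +kernel) (by decide +kernel)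
    (n₁ := 14) (n₂ := 51) (by decide +kernel) (by decide +kernel) (by decide) (by decide) (by decide) (by decide)
    2 ⟨2, 1, 1, 0, 0, 0, 0, 15, 0, 0, 15⟩ rfl (by decide +kernel) (c := 15) (by decide +kernel) (w := 1) (by decide +kernel) (by decide)
    hJ hMcU hGZK hKo hrec hD36 hlev W hW hK hD3 hD4 hH hP hnt hqN hv hr hs hvs

/-- **`BSD(E,3)` for `408090j1`** (cell `(408090j1, 3)`, class X11b, rank 1; JET grammar key `JETB:408090j1@3`, bucket B at `p = 3 ∥ N`, carrier `3`
(door `JET.bsdp_of_jetRowB3_tam_min`)); `N = 408090 = 2·3·5·61·223`, split `I12` at `3`, `r_an = 1`, `#E(ℚ)_tors = 1`, `∏c = 120`, `#Ш_an = 1`,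
Cremona galrep: no code at this prime (`ρ̄_{E,3}` onto); `|Δ| = ∏` over `[(2, 7), (3, 12), (5, 1), (61, 5), (223, 2)]` (factored Kraus criterion,
every disjunct decided). The ONE carrier: carrier `q = 3` (split `I12`, `c_q = 12`, `w = ord_3 c_q = 1`; IN THE KERNEL by the `TamLocal` certificate
`⟨3, 1, 1, 0, 0, 0, 0, 12, 0, 0, 12⟩`); READING binder `hJ` = K3 `JetchevDivisibilityCarrierMult`; displayed index line `hv : ord_3 [E(K):ℤP] ≤ 1`.
Serre Prop-15 witnesses mod `3`: `(ℓ, #Ẽ(𝔽_ℓ))` = `(11, 14)` (`X² − aX + ℓ` root-free over `𝔽₃`), `(13, 15)` (`ℓ ≡ 1`, `a ≡ 2 (mod 3)`, `9 ∤ #Ẽ`).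
Kurihara lane note of record: «multiplicative p, r=1, irr (Castella 2018 Thm A withdrawn for p||N)». State of record (referee A ROUND 983,
`scratchA_A_state_after_x4gh_add3_onA2R977_fold.pkl`): class `residue`, 1 open cell(s), register empty. Other engine-1 fields tried (`D`: `m`
(`ord_3 m`)): `-431`: `m = 720` (`ord = 2`); `-839`: `m = 720` (`ord = 2`); `-1079`: `m = 720` (`ord = 2`); `-1559`: `m = 480` (`ord = 1`); `-1631`:
`m = 240` (`ord = 1`); `-1871`: `m = 480` (`ord = 1`); `-1991`: `m = 720` (`ord = 2`); `-2639`: `m = 240` (`ord = 1`); `-2831`: `m = 240` (`ord =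
1`); `-3551`: `m = 240` (`ord = 1`); `-3839`: `m = 240` (`ord = 1`); `-4151`: `m = 480` (`ord = 1`); `-4391`: `m = 960` (`ord = 1`); `-4511`: `m =
1920` (`ord = 1`). THIS UNIT'S DATUM (displayed, NOT re-computed here): DEEP FIELD `K = ℚ(√-1511)` (`1511` = prime): **`m = [E(K):ℤy_K] = 240`,
`ord_3 m = 1`** (`ρ = m²/4`, `L'(E,1) = 6.0645550111`, `L(E^D,1) = 0.2874866717`, `ĥ(P) = 0.4341614009`; Cremona's generator) — engine 1 j293234 =
engine 2 j294330: `m = 240` EQUAL (AGREE v_p(m)=1, dev ≤ 2.1e-13); twist `E^D` (j294332): `N = 931718848890`, `#tors·∏c·#Ш_an = 1·240·1`, `ord_3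
#Ш_an(E^D) = 0`, `ord_3 ∏c(E^D) = 1` (BSD-consistent). CONDITIONAL on every binder; per cell; nothing booked by this file.
[cite: Jetchev2008, Thm. 1.4 and Cor. 1.5 (p. 812)] [cite: McCallumLMS1991, Cor. 5.6] [cite: Serre1972, §2.4 Prop. 15, §2.8 Prop. 19] [cite: Cremona2006, Table 1 (label 408090j1)] -/
theorem bsdpJD_408090j1_3
    (hJ : JetchevDivisibilityCarrierMult)
    (hMcU : McCallum1991_padicValNat_card_sha_primary_add_le_of_globalDivisibility)
    (hGZK : rank_eq_analyticRank_of_analyticRank_le_one)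
    (hKo : ∀ (N : ℕ) [NeZero N] (W : WeierstrassCurve ℚ) (K : Type) [Field K] [NumberField K], kolyvagin N W K)
    (hrec : ∀ (N : ℕ) [NeZero N] (W : WeierstrassCurve ℚ) (K : Type) [Field K] [NumberField K],
      heegnerPointOfConductor_one_galoisConj N W K)
    (hD36 : ∀ (N : ℕ) [NeZero N] (W : WeierstrassCurve ℚ) (K : Type) [Field K] [NumberField K],
      phi_heegnerTau_mem_singularModuliField N W K)
    (hlev : ∀ {N : ℕ} [NeZero N], IsNewformOf.level_eq_conductorNorm (N := N))
    (W : WeierstrassCurve ℚ) (hW : W = ⟨1, 0, 1, -6266078, 8337163088⟩)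
    {N : ℕ} [NeZero N] {K : Type} [Field K] [NumberField K] (hK : IsImaginaryQuadratic K)
    (hD3 : NumberField.discr K ≠ -3) (hD4 : NumberField.discr K ≠ -4)
    (hH : SatisfiesHeegnerHypothesis N K) {P : (W.baseChange K).toAffine.Point}
    (hP : IsHeegnerPoint N W K P) (hnt : ¬ IsOfFinAddOrder P)
    (hv : padicValNat 3 (AddSubgroup.zmultiples P).index ≤ 1)
    (hr : W.analyticRank ≤ 1) {s : ℚ} (hs : shaAn W = (s : ℂ)) (hvs : padicValRat 3 s = 0) : BSDp W 3 :=
  bsdp_of_jetRowB3_tam_min 1 0 1 (-6266078) 8337163088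
    (Supersingular.isGloballyMinimal_of_krausCriterion₃_factored 1 0 1 (-6266078) 8337163088 [(2, 7), (3, 12), (5, 1), (61, 5), (223, 2)] (by decide +kernel)
      (by intro t ht; fin_cases ht <;> norm_num) (by decide +kernel))
    (by decide +kernel) (by decide +kernel)
    11 13 (by norm_num) (by norm_num) (by decide) (by decide) (by decide) (by decide) (by decide +kernel) (by decide +kernel)
    (n₁ := 14) (n₂ := 15) (by decide +kernel) (by decide +kernel) (by decide) (by decide) (by decide) (by decide)
    ⟨3, 1, 1, 0, 0, 0, 0, 12, 0, 0, 12⟩ rfl (by decide +kernel) (c := 12) (by decide +kernel) (w := 1) (by decide +kernel)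
    hJ hMcU hGZK hKo hrec hD36 hlev W hW hK hD3 hD4 hH hP hnt hv hr hs hvs

/-- **`BSD(E,3)` for `409146e1`** (cell `(409146e1, 3)`, class X11b, rank 1; JET grammar key `JETA:409146e1@3`, bucket A at `p = 3 ∥ N` (door
`JET.bsdp_of_jetRowA3_tam_min`)); `N = 409146 = 2·3·19·37·97`, nonsplit `I20` at `3`, `r_an = 1`, `#E(ℚ)_tors = 1`, `∏c = 12`, `#Ш_an = 1`, Cremona
galrep: no code at this prime (`ρ̄_{E,3}` onto); `|Δ| = ∏` over `[(2, 3), (3, 20), (19, 1), (37, 1), (97, 2)]` (factored Kraus criterion, every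
disjunct decided). The ONE carrier: carrier `q = 2` (split `I3`, `c_q = 3`, `w = ord_3 c_q = 1`; IN THE KERNEL by the `TamLocal` certificate `⟨2, 1,
1, 0, 0, 0, 0, 3, 0, 0, 3⟩`); READING binder `hJ` = K1 `JetchevDivisibilityCarrierNe`; displayed index line `hv : ord_3 [E(K):ℤP] ≤ 1`. Serre
Prop-15 witnesses mod `3`: `(ℓ, #Ẽ(𝔽_ℓ))` = `(5, 7)` (`X² − aX + ℓ` root-free over `𝔽₃`), `(43, 48)` (`ℓ ≡ 1`, `a ≡ 2 (mod 3)`, `9 ∤ #Ẽ`). Kurihara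
lane note of record: «multiplicative p, r=1, irr (Castella 2018 Thm A withdrawn for p||N)». State of record (referee A ROUND 983,
`scratchA_A_state_after_x4gh_add3_onA2R977_fold.pkl`): class `residue`, 1 open cell(s), register empty. Other engine-1 fields tried (`D`: `m`
(`ord_3 m`)): `-287`: `m = 144` (`ord = 2`); `-743`: `m = 72` (`ord = 2`); `-1439`: `m = 72` (`ord = 2`); `-1655`: `m = 72` (`ord = 2`); `-2615`: `m
= 24` (`ord = 1`); `-2663`: `m = 360` (`ord = 2`); `-2879`: `m = 24` (`ord = 1`); `-3023`: `m = 96` (`ord = 1`); `-3263`: `m = 96` (`ord = 1`);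
`-3527`: `m = 96` (`ord = 1`); `-3815`: `m = 96` (`ord = 1`); `-4271`: `m = 192` (`ord = 1`); `-4487`: `m = 48` (`ord = 1`); `-4511`: `m = 288`
(`ord = 2`); `-4535`: `m = 264` (`ord = 1`). THIS UNIT'S DATUM (displayed, NOT re-computed here): DEEP FIELD `K = ℚ(√-1703)` (`1703` = 13·131): **`m
= [E(K):ℤy_K] = 48`, `ord_3 m = 1`** (`ρ = m²/4`, `L'(E,1) = 8.0748915050`, `L(E^D,1) = 0.3482521318`, `ĥ(P) = 2.8771856506`; Cremona's generator) —
engine 1 j293239 = engine 2 j294065: `m = 48` EQUAL (AGREE v_p(m)=1, dev ≤ 4.6e-15); twist `E^D` (j294066): `N = 1186608911514`, `#tors·∏c·#Ш_an =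
1·48·1`, `ord_3 #Ш_an(E^D) = 0`, `ord_3 ∏c(E^D) = 1` (BSD-consistent). CONDITIONAL on every binder; per cell; nothing booked by this file.
[cite: Jetchev2008, Thm. 1.4 and Cor. 1.5 (p. 812)] [cite: McCallumLMS1991, Cor. 5.6] [cite: Serre1972, §2.4 Prop. 15, §2.8 Prop. 19] [cite: Cremona2006, Table 1 (label 409146e1)] -/
theorem bsdpJD_409146e1_3
    (hJ : JetchevDivisibilityCarrierNe)
    (hMcU : McCallum1991_padicValNat_card_sha_primary_add_le_of_globalDivisibility)
    (hGZK : rank_eq_analyticRank_of_analyticRank_le_one)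
    (hKo : ∀ (N : ℕ) [NeZero N] (W : WeierstrassCurve ℚ) (K : Type) [Field K] [NumberField K], kolyvagin N W K)
    (hrec : ∀ (N : ℕ) [NeZero N] (W : WeierstrassCurve ℚ) (K : Type) [Field K] [NumberField K],
      heegnerPointOfConductor_one_galoisConj N W K)
    (hD36 : ∀ (N : ℕ) [NeZero N] (W : WeierstrassCurve ℚ) (K : Type) [Field K] [NumberField K],
      phi_heegnerTau_mem_singularModuliField N W K)
    (hlev : ∀ {N : ℕ} [NeZero N], IsNewformOf.level_eq_conductorNorm (N := N))
    (W : WeierstrassCurve ℚ) (hW : W = ⟨1, 1, 1, -187061, -23372125⟩)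
    {N : ℕ} [NeZero N] {K : Type} [Field K] [NumberField K] (hK : IsImaginaryQuadratic K)
    (hD3 : NumberField.discr K ≠ -3) (hD4 : NumberField.discr K ≠ -4)
    (hH : SatisfiesHeegnerHypothesis N K) {P : (W.baseChange K).toAffine.Point}
    (hP : IsHeegnerPoint N W K P) (hnt : ¬ IsOfFinAddOrder P) (hqN : 2 ∣ N)
    (hv : padicValNat 3 (AddSubgroup.zmultiples P).index ≤ 1)
    (hr : W.analyticRank ≤ 1) {s : ℚ} (hs : shaAn W = (s : ℂ)) (hvs : padicValRat 3 s = 0) : BSDp W 3 :=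
  bsdp_of_jetRowA3_tam_min 1 1 1 (-187061) (-23372125)
    (Supersingular.isGloballyMinimal_of_krausCriterion₃_factored 1 1 1 (-187061) (-23372125) [(2, 3), (3, 20), (19, 1), (37, 1), (97, 2)] (by decide +kernel)
      (by intro t ht; fin_cases ht <;> norm_num) (by decide +kernel))
    (by decide +kernel) (by decide +kernel)
    5 43 (by norm_num) (by norm_num) (by decide) (by decide) (by decide) (by decide) (by decide +kernel) (by decide +kernel)
    (n₁ := 7) (n₂ := 48) (by decide +kernel) (by decide +kernel) (by decide) (by decide) (by decide) (by decide)
    2 ⟨2, 1, 1, 0, 0, 0, 0, 3, 0, 0, 3⟩ rfl (by decide +kernel) (c := 3) (by decide +kernel) (w := 1) (by decide +kernel) (by decide)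
    hJ hMcU hGZK hKo hrec hD36 hlev W hW hK hD3 hD4 hH hP hnt hqN hv hr hs hvs

/-- **`BSD(E,3)` for `412230cm1`** (cell `(412230cm1, 3)`, class X11b, rank 1; JET grammar key `JETB:412230cm1@3`, bucket B at `p = 3 ∥ N`, carrier
`3` (door `JET.bsdp_of_jetRowB3_tam_min`)); `N = 412230 = 2·3·5·7·13·151`, split `I3` at `3`, `r_an = 1`, `#E(ℚ)_tors = 2`, `∏c = 96`, `#Ш_an = 1`,
Cremona galrep: no code at this prime (`ρ̄_{E,3}` onto); `|Δ| = ∏` over `[(2, 8), (3, 3), (5, 1), (7, 2), (13, 2), (151, 1)]` (factored Kraus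
criterion, every disjunct decided). The ONE carrier: carrier `q = 3` (split `I3`, `c_q = 3`, `w = ord_3 c_q = 1`; IN THE KERNEL by the `TamLocal`
certificate `⟨3, 1, 1, 0, 0, 0, 0, 3, 0, 0, 3⟩`); READING binder `hJ` = K3 `JetchevDivisibilityCarrierMult`; displayed index line `hv : ord_3
[E(K):ℤP] ≤ 1`. Serre Prop-15 witnesses mod `3`: `(ℓ, #Ẽ(𝔽_ℓ))` = `(17, 20)` (`X² − aX + ℓ` root-free over `𝔽₃`), `(37, 42)` (`ℓ ≡ 1`, `a ≡ 2 (mod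
3)`, `9 ∤ #Ẽ`). Kurihara lane note of record: «multiplicative p, r=1, irr (Castella 2018 Thm A withdrawn for p||N)». State of record (referee A
ROUND 983, `scratchA_A_state_after_x4gh_add3_onA2R977_fold.pkl`): class `residue`, 1 open cell(s), register empty. Other engine-1 fields tried (`D`:
`m` (`ord_3 m`)): `-719`: `m = 288` (`ord = 2`); `-3071`: `m = 288` (`ord = 2`); `-4679`: `m = 288` (`ord = 2`). THIS UNIT'S DATUM (displayed, NOT
re-computed here): DEEP FIELD `K = ℚ(√-2831)` (`2831` = 19·149): **`m = [E(K):ℤy_K] = 192`, `ord_3 m = 1`** (`ρ = m²/4`, `L'(E,1) = 19.080571553`,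
`L(E^D,1) = 6.6386727256`, `ĥ(P) = 0.7916089330`; Cremona's generator) — engine 1 j293228 = engine 2 j293889: `m = 192` EQUAL (AGREE v_p(m)=1, dev ≤
7.8e-14); twist `E^D` (j293892): `N = 3303842481030`, `#tors·∏c·#Ш_an = 2·1536·1`, `ord_3 #Ш_an(E^D) = 0`, `ord_3 ∏c(E^D) = 1` (BSD-consistent).
CONDITIONAL on every binder; per cell; nothing booked by this file.
[cite: Jetchev2008, Thm. 1.4 and Cor. 1.5 (p. 812)] [cite: McCallumLMS1991, Cor. 5.6] [cite: Serre1972, §2.4 Prop. 15, §2.8 Prop. 19] [cite: Cremona2006, Table 1 (label 412230cm1)] -/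
theorem bsdpJD_412230cm1_3
    (hJ : JetchevDivisibilityCarrierMult)
    (hMcU : McCallum1991_padicValNat_card_sha_primary_add_le_of_globalDivisibility)
    (hGZK : rank_eq_analyticRank_of_analyticRank_le_one)
    (hKo : ∀ (N : ℕ) [NeZero N] (W : WeierstrassCurve ℚ) (K : Type) [Field K] [NumberField K], kolyvagin N W K)
    (hrec : ∀ (N : ℕ) [NeZero N] (W : WeierstrassCurve ℚ) (K : Type) [Field K] [NumberField K],
      heegnerPointOfConductor_one_galoisConj N W K)
    (hD36 : ∀ (N : ℕ) [NeZero N] (W : WeierstrassCurve ℚ) (K : Type) [Field K] [NumberField K],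
      phi_heegnerTau_mem_singularModuliField N W K)
    (hlev : ∀ {N : ℕ} [NeZero N], IsNewformOf.level_eq_conductorNorm (N := N))
    (W : WeierstrassCurve ℚ) (hW : W = ⟨1, 0, 0, -910, 3332⟩)
    {N : ℕ} [NeZero N] {K : Type} [Field K] [NumberField K] (hK : IsImaginaryQuadratic K)
    (hD3 : NumberField.discr K ≠ -3) (hD4 : NumberField.discr K ≠ -4)
    (hH : SatisfiesHeegnerHypothesis N K) {P : (W.baseChange K).toAffine.Point}
    (hP : IsHeegnerPoint N W K P) (hnt : ¬ IsOfFinAddOrder P)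
    (hv : padicValNat 3 (AddSubgroup.zmultiples P).index ≤ 1)
    (hr : W.analyticRank ≤ 1) {s : ℚ} (hs : shaAn W = (s : ℂ)) (hvs : padicValRat 3 s = 0) : BSDp W 3 :=
  bsdp_of_jetRowB3_tam_min 1 0 0 (-910) 3332
    (Supersingular.isGloballyMinimal_of_krausCriterion₃_factored 1 0 0 (-910) 3332 [(2, 8), (3, 3), (5, 1), (7, 2), (13, 2), (151, 1)] (by decide +kernel)
      (by intro t ht; fin_cases ht <;> norm_num) (by decide +kernel))
    (by decide +kernel) (by decide +kernel)
    17 37 (by norm_num) (by norm_num) (by decide) (by decide) (by decide) (by decide) (by decide +kernel) (by decide +kernel)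
    (n₁ := 20) (n₂ := 42) (by decide +kernel) (by decide +kernel) (by decide) (by decide) (by decide) (by decide)
    ⟨3, 1, 1, 0, 0, 0, 0, 3, 0, 0, 3⟩ rfl (by decide +kernel) (c := 3) (by decide +kernel) (w := 1) (by decide +kernel)
    hJ hMcU hGZK hKo hrec hD36 hlev W hW hK hD3 hD4 hH hP hnt hv hr hs hvs

end Summit.BirchSwinnertonDyer.Rank1Residual.X11b

end
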